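import Summits.Ventures.PercRepro.C026PendantProbeLemmas

/-!
# The pendant probe: the count identities (p6, gen 20)

Part 2 of «`(E00)` is invariant under a pendant probe» (mine-3 §35 (d); `C026PendantProbeLemmas`,
`C026PFunPendantProbe`).  For a probe `c` whose only edge is `e = c–u` (`u ≠ c`, `a ≠ c`, `b ≠ c`):

* every `c`-count of `(E00)` needs `e` red, and with `e` red the `c`-types are read off the `u`-types —
  `filter_DA_c_eq` (`n_c(D,A)` = the `e`-red configurations of `u`-red type `D` with `a ≁_blue b`),
  `filter_B_c_eq`, `filter_BC_c_eq`, `filter_DnA_c_eq`;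
* every `u`-count doubles its `e`-red part — `card_DA_u_eq`, `card_B_u_eq`, `card_BC_u_eq`,
  `card_DnA_u_eq` (the flip of `e` keeps every connection away from `c`, `conn_flipE_iff`);
* the `e`-red counts split by the blue type — `card_D_notab_split`, `card_D_notA_split`,
  `card_B_ab_split`;
* `U(D,B) = U(B,D)` — `card_DB_eq_card_BD`, by complementation with `e` re-opened (`complE`,
  `conn_complE_iff`, `conn_compl_complE_iff`).
-/

namespace PercRepro

namespace MultiGraph

open Finset

variable {V E : Type*} {G : MultiGraph V E}

section Pendant

variable [DecidableEq E] {e : E} {c u : V}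

section Count

variable [Fintype E]

variable [Fintype V] [DecidableEq V]

section Identities

variable (hleaf : ∀ f, G.fst f = c ∨ G.snd f = c → f = e)
  (hend : (G.fst e = c ∧ G.snd e = u) ∨ (G.fst e = u ∧ G.snd e = c)) (hcu : u ≠ c)
  {a b : V} (hac : a ≠ c) (hbc : b ≠ c)
include hleaf hend hac hbc

omit [Fintype V] [DecidableEq V] in
open Classical in
/-- `n_c(D,A)` = the `e`-red configurations with `u`-red type `D` and `a ≁_blue b`. -/
theorem filter_DA_c_eq :
    (univ.filter fun S : Config E => (G.Conn S c a ∧ G.Conn S c b) ∧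
        (¬ G.Conn Sᶜ c a ∧ ¬ G.Conn Sᶜ c b ∧ ¬ G.Conn Sᶜ a b)) =
      (univ.filter fun S : Config E => S e = true ∧
        ((G.Conn S u a ∧ G.Conn S u b) ∧ ¬ G.Conn Sᶜ a b)) := by
  apply Finset.filter_congr
  intro S _
  constructor
  · rintro ⟨⟨hca, hcb⟩, _, _, hab⟩
    have he : S e = true := by
      by_contra h
      exact not_conn_c_of_closed hleaf (Bool.eq_false_iff.2 h) hac hca
    exact ⟨he, ⟨(conn_c_iff_conn_u hend he a).1 hca, (conn_c_iff_conn_u hend he b).1 hcb⟩, hab⟩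
  · rintro ⟨he, ⟨hua, hub⟩, hab⟩
    exact ⟨⟨(conn_c_iff_conn_u hend he a).2 hua, (conn_c_iff_conn_u hend he b).2 hub⟩,
      not_conn_compl_c_of_open hleaf he hac, not_conn_compl_c_of_open hleaf he hbc, hab⟩

omit [Fintype V] [DecidableEq V] in
open Classical in
/-- `|B|_c` = the `e`-red configurations with `u`-red type `B`. -/
theorem filter_B_c_eq :
    (univ.filter fun S : Config E =>
        (G.Conn S c a ∧ ¬ G.Conn S c b) ∨ (G.Conn S c b ∧ ¬ G.Conn S c a)) =
      (univ.filter fun S : Config E => S e = true ∧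
        ((G.Conn S u a ∧ ¬ G.Conn S u b) ∨ (G.Conn S u b ∧ ¬ G.Conn S u a))) := by
  apply Finset.filter_congr
  intro S _
  constructor
  · intro h
    have he : S e = true := by
      by_contra h'
      rcases h with ⟨hca, _⟩ | ⟨hcb, _⟩
      · exact not_conn_c_of_closed hleaf (Bool.eq_false_iff.2 h') hac hca
      · exact not_conn_c_of_closed hleaf (Bool.eq_false_iff.2 h') hbc hcb
    refine ⟨he, ?_⟩
    rw [conn_c_iff_conn_u hend he a, conn_c_iff_conn_u hend he b] at h
    exact h
  · rintro ⟨he, h⟩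
    rw [conn_c_iff_conn_u hend he a, conn_c_iff_conn_u hend he b]
    exact h

omit [Fintype V] [DecidableEq V] in
open Classical in
/-- `n_c(B,C)` = the `e`-red configurations with `u`-red type `B` and `a ~_blue b`. -/
theorem filter_BC_c_eq :
    (univ.filter fun S : Config E =>
        ((G.Conn S c a ∧ ¬ G.Conn S c b) ∨ (G.Conn S c b ∧ ¬ G.Conn S c a)) ∧
        (G.Conn Sᶜ a b ∧ ¬ G.Conn Sᶜ c a)) =
      (univ.filter fun S : Config E => S e = true ∧
        (((G.Conn S u a ∧ ¬ G.Conn S u b) ∨ (G.Conn S u b ∧ ¬ G.Conn S u a)) ∧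
          G.Conn Sᶜ a b)) := by
  apply Finset.filter_congr
  intro S _
  constructor
  · rintro ⟨h, hab, _⟩
    have he : S e = true := by
      by_contra h'
      rcases h with ⟨hca, _⟩ | ⟨hcb, _⟩
      · exact not_conn_c_of_closed hleaf (Bool.eq_false_iff.2 h') hac hca
      · exact not_conn_c_of_closed hleaf (Bool.eq_false_iff.2 h') hbc hcb
    refine ⟨he, ?_, hab⟩
    rw [conn_c_iff_conn_u hend he a, conn_c_iff_conn_u hend he b] at h
    exact h
  · rintro ⟨he, h, hab⟩
    refine ⟨?_, hab, not_conn_compl_c_of_open hleaf he hac⟩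
    rw [conn_c_iff_conn_u hend he a, conn_c_iff_conn_u hend he b]
    exact h

omit [Fintype V] [DecidableEq V] in
open Classical in
/-- `n_c(D,¬A)` = the `e`-red configurations with `u`-red type `D` and `a ~_blue b`. -/
theorem filter_DnA_c_eq :
    (univ.filter fun S : Config E => (G.Conn S c a ∧ G.Conn S c b) ∧
        (G.Conn Sᶜ c a ∨ G.Conn Sᶜ c b ∨ G.Conn Sᶜ a b)) =
      (univ.filter fun S : Config E => S e = true ∧
        ((G.Conn S u a ∧ G.Conn S u b) ∧ G.Conn Sᶜ a b)) := by
  apply Finset.filter_congr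
  intro S _
  constructor
  · rintro ⟨⟨hca, hcb⟩, h⟩
    have he : S e = true := by
      by_contra h'
      exact not_conn_c_of_closed hleaf (Bool.eq_false_iff.2 h') hac hca
    refine ⟨he, ⟨(conn_c_iff_conn_u hend he a).1 hca, (conn_c_iff_conn_u hend he b).1 hcb⟩, ?_⟩
    rcases h with h | h | h
    · exact absurd h (not_conn_compl_c_of_open hleaf he hac)
    · exact absurd h (not_conn_compl_c_of_open hleaf he hbc)
    · exact h
  · rintro ⟨he, ⟨hua, hub⟩, hab⟩
    exact ⟨⟨(conn_c_iff_conn_u hend he a).2 hua, (conn_c_iff_conn_u hend he b).2 hub⟩,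
      Or.inr (Or.inr hab)⟩

omit [Fintype E] [Fintype V] [DecidableEq V] hac hbc in
/-- Flipping `e` keeps every red or blue connection between vertices other than `c`. -/
theorem conn_flipE_iff {S : Config E} {x y : V} (hx : x ≠ c) (hy : y ≠ c) :
    (G.Conn (flipE e S) x y ↔ G.Conn S x y) ∧ (G.Conn (flipE e S)ᶜ x y ↔ G.Conn Sᶜ x y) :=
  ⟨conn_update_iff_of_ne hleaf hend hx hy _, conn_compl_update_iff_of_ne hleaf hend hx hy _⟩

include hcu

omit [Fintype V] [DecidableEq V] in
open Classical in
/-- `n_u(D,A)` doubles its `e`-red part. -/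
theorem card_DA_u_eq :
    (univ.filter fun S : Config E => (G.Conn S u a ∧ G.Conn S u b) ∧
        (¬ G.Conn Sᶜ u a ∧ ¬ G.Conn Sᶜ u b ∧ ¬ G.Conn Sᶜ a b)).card =
      2 * (univ.filter fun S : Config E => S e = true ∧ ((G.Conn S u a ∧ G.Conn S u b) ∧
        (¬ G.Conn Sᶜ u a ∧ ¬ G.Conn Sᶜ u b ∧ ¬ G.Conn Sᶜ a b))).card := by
  apply card_filter_eq_two_mul_of_flipE
  intro S
  rw [(conn_flipE_iff hleaf hend hcu hac).1, (conn_flipE_iff hleaf hend hcu hbc).1,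
    (conn_flipE_iff hleaf hend hcu hac).2, (conn_flipE_iff hleaf hend hcu hbc).2,
    (conn_flipE_iff hleaf hend hac hbc).2]

omit [Fintype V] [DecidableEq V] in
open Classical in
/-- `|B|_u` doubles its `e`-red part. -/
theorem card_B_u_eq :
    (univ.filter fun S : Config E =>
        (G.Conn S u a ∧ ¬ G.Conn S u b) ∨ (G.Conn S u b ∧ ¬ G.Conn S u a)).card =
      2 * (univ.filter fun S : Config E => S e = true ∧
        ((G.Conn S u a ∧ ¬ G.Conn S u b) ∨ (G.Conn S u b ∧ ¬ G.Conn S u a))).card := by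
  apply card_filter_eq_two_mul_of_flipE
  intro S
  rw [(conn_flipE_iff hleaf hend hcu hac).1, (conn_flipE_iff hleaf hend hcu hbc).1]

omit [Fintype V] [DecidableEq V] in
open Classical in
/-- `n_u(B,C)` doubles its `e`-red part. -/
theorem card_BC_u_eq :
    (univ.filter fun S : Config E =>
        ((G.Conn S u a ∧ ¬ G.Conn S u b) ∨ (G.Conn S u b ∧ ¬ G.Conn S u a)) ∧
        (G.Conn Sᶜ a b ∧ ¬ G.Conn Sᶜ u a)).card =
      2 * (univ.filter fun S : Config E => S e = true ∧
        (((G.Conn S u a ∧ ¬ G.Conn S u b) ∨ (G.Conn S u b ∧ ¬ G.Conn S u a)) ∧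
        (G.Conn Sᶜ a b ∧ ¬ G.Conn Sᶜ u a))).card := by
  apply card_filter_eq_two_mul_of_flipE
  intro S
  rw [(conn_flipE_iff hleaf hend hcu hac).1, (conn_flipE_iff hleaf hend hcu hbc).1,
    (conn_flipE_iff hleaf hend hac hbc).2, (conn_flipE_iff hleaf hend hcu hac).2]

omit [Fintype V] [DecidableEq V] in
open Classical in
/-- `n_u(D,¬A)` doubles its `e`-red part. -/
theorem card_DnA_u_eq :
    (univ.filter fun S : Config E => (G.Conn S u a ∧ G.Conn S u b) ∧
        (G.Conn Sᶜ u a ∨ G.Conn Sᶜ u b ∨ G.Conn Sᶜ a b)).card =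
      2 * (univ.filter fun S : Config E => S e = true ∧ ((G.Conn S u a ∧ G.Conn S u b) ∧
        (G.Conn Sᶜ u a ∨ G.Conn Sᶜ u b ∨ G.Conn Sᶜ a b))).card := by
  apply card_filter_eq_two_mul_of_flipE
  intro S
  rw [(conn_flipE_iff hleaf hend hcu hac).1, (conn_flipE_iff hleaf hend hcu hbc).1,
    (conn_flipE_iff hleaf hend hcu hac).2, (conn_flipE_iff hleaf hend hcu hbc).2,
    (conn_flipE_iff hleaf hend hac hbc).2]

omit [Fintype V] [DecidableEq V] hleaf hend hcu hac hbc in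
open Classical in
/-- The `e`-red `u`-type-`D` configurations with `a ≁_blue b` split by the blue type `A` / `B`. -/
theorem card_D_notab_split :
    (univ.filter fun S : Config E => S e = true ∧
        ((G.Conn S u a ∧ G.Conn S u b) ∧ ¬ G.Conn Sᶜ a b)).card =
      (univ.filter fun S : Config E => S e = true ∧ ((G.Conn S u a ∧ G.Conn S u b) ∧
        (¬ G.Conn Sᶜ u a ∧ ¬ G.Conn Sᶜ u b ∧ ¬ G.Conn Sᶜ a b))).card +
      (univ.filter fun S : Config E => S e = true ∧ ((G.Conn S u a ∧ G.Conn S u b) ∧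
        ((G.Conn Sᶜ u a ∧ ¬ G.Conn Sᶜ u b) ∨ (G.Conn Sᶜ u b ∧ ¬ G.Conn Sᶜ u a)))).card := by
  rw [← Finset.card_filter_add_card_filter_not
    (s := univ.filter fun S : Config E => S e = true ∧
      ((G.Conn S u a ∧ G.Conn S u b) ∧ ¬ G.Conn Sᶜ a b))
    (fun S : Config E => ¬ G.Conn Sᶜ u a ∧ ¬ G.Conn Sᶜ u b ∧ ¬ G.Conn Sᶜ a b)]
  rw [Finset.filter_filter, Finset.filter_filter]
  congr 1
  · congr 1
    apply Finset.filter_congr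
    intro S _
    constructor
    · rintro ⟨⟨he, hD, _⟩, hA⟩
      exact ⟨he, hD, hA⟩
    · rintro ⟨he, hD, hA⟩
      exact ⟨⟨he, hD, hA.2.2⟩, hA⟩
  · congr 1
    apply Finset.filter_congr
    intro S _
    constructor
    · rintro ⟨⟨he, hD, hab⟩, hA⟩
      refine ⟨he, hD, ?_⟩
      by_cases hua : G.Conn Sᶜ u a
      · exact Or.inl ⟨hua, fun hub => hab (hua.symm.trans hub)⟩
      · by_cases hub : G.Conn Sᶜ u b
        · exact Or.inr ⟨hub, hua⟩
        · exact absurd ⟨hua, hub, hab⟩ hA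
    · rintro ⟨he, hD, hB⟩
      rcases hB with ⟨hua, hub⟩ | ⟨hub, hua⟩
      · exact ⟨⟨he, hD, fun hab => hub (hua.trans hab)⟩, fun hA => hA.1 hua⟩
      · exact ⟨⟨he, hD, fun hab => hua (hub.trans hab.symm)⟩, fun hA => hA.2.1 hub⟩

omit [Fintype V] [DecidableEq V] hleaf hend hcu hac hbc in
open Classical in
/-- The `e`-red `u`-type-`D` configurations of blue type `≠ A` split by `a ~_blue b`. -/
theorem card_D_notA_split :
    (univ.filter fun S : Config E => S e = true ∧ ((G.Conn S u a ∧ G.Conn S u b) ∧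
        (G.Conn Sᶜ u a ∨ G.Conn Sᶜ u b ∨ G.Conn Sᶜ a b))).card =
      (univ.filter fun S : Config E => S e = true ∧ ((G.Conn S u a ∧ G.Conn S u b) ∧
        G.Conn Sᶜ a b)).card +
      (univ.filter fun S : Config E => S e = true ∧ ((G.Conn S u a ∧ G.Conn S u b) ∧
        ((G.Conn Sᶜ u a ∧ ¬ G.Conn Sᶜ u b) ∨ (G.Conn Sᶜ u b ∧ ¬ G.Conn Sᶜ u a)))).card := by
  rw [← Finset.card_filter_add_card_filter_not
    (s := univ.filter fun S : Config E => S e = true ∧ ((G.Conn S u a ∧ G.Conn S u b) ∧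
      (G.Conn Sᶜ u a ∨ G.Conn Sᶜ u b ∨ G.Conn Sᶜ a b)))
    (fun S : Config E => G.Conn Sᶜ a b)]
  rw [Finset.filter_filter, Finset.filter_filter]
  congr 1
  · congr 1
    apply Finset.filter_congr
    intro S _
    constructor
    · rintro ⟨⟨he, hD, _⟩, hab⟩
      exact ⟨he, hD, hab⟩
    · rintro ⟨he, hD, hab⟩
      exact ⟨⟨he, hD, Or.inr (Or.inr hab)⟩, hab⟩
  · congr 1
    apply Finset.filter_congr
    intro S _
    constructor
    · rintro ⟨⟨he, hD, h⟩, hab⟩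
      refine ⟨he, hD, ?_⟩
      rcases h with hua | hub | hab'
      · exact Or.inl ⟨hua, fun hub => hab (hua.symm.trans hub)⟩
      · exact Or.inr ⟨hub, fun hua => hab (hua.symm.trans hub)⟩
      · exact absurd hab' hab
    · rintro ⟨he, hD, hB⟩
      rcases hB with ⟨hua, hub⟩ | ⟨hub, hua⟩
      · exact ⟨⟨he, hD, Or.inl hua⟩, fun hab => hub (hua.trans hab)⟩
      · exact ⟨⟨he, hD, Or.inr (Or.inl hub)⟩, fun hab => hua (hub.trans hab.symm)⟩

omit [Fintype V] [DecidableEq V] hleaf hend hcu hac hbc in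
open Classical in
/-- The `e`-red `u`-type-`B` configurations with `a ~_blue b` split by `u ~_blue a`. -/
theorem card_B_ab_split :
    (univ.filter fun S : Config E => S e = true ∧
        (((G.Conn S u a ∧ ¬ G.Conn S u b) ∨ (G.Conn S u b ∧ ¬ G.Conn S u a)) ∧
          G.Conn Sᶜ a b)).card =
      (univ.filter fun S : Config E => S e = true ∧
        (((G.Conn S u a ∧ ¬ G.Conn S u b) ∨ (G.Conn S u b ∧ ¬ G.Conn S u a)) ∧
        (G.Conn Sᶜ a b ∧ ¬ G.Conn Sᶜ u a))).card +
      (univ.filter fun S : Config E => S e = true ∧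
        (((G.Conn S u a ∧ ¬ G.Conn S u b) ∨ (G.Conn S u b ∧ ¬ G.Conn S u a)) ∧
        (G.Conn Sᶜ a b ∧ G.Conn Sᶜ u a))).card := by
  rw [← Finset.card_filter_add_card_filter_not
    (s := univ.filter fun S : Config E => S e = true ∧
      (((G.Conn S u a ∧ ¬ G.Conn S u b) ∨ (G.Conn S u b ∧ ¬ G.Conn S u a)) ∧ G.Conn Sᶜ a b))
    (fun S : Config E => ¬ G.Conn Sᶜ u a)]
  rw [Finset.filter_filter, Finset.filter_filter]
  congr 1
  · congr 1
    apply Finset.filter_congr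
    intro S _
    constructor
    · rintro ⟨⟨he, hB, hab⟩, hua⟩
      exact ⟨he, hB, hab, hua⟩
    · rintro ⟨he, hB, hab, hua⟩
      exact ⟨⟨he, hB, hab⟩, hua⟩
  · congr 1
    apply Finset.filter_congr
    intro S _
    constructor
    · rintro ⟨⟨he, hB, hab⟩, hua⟩
      exact ⟨he, hB, hab, not_not.1 hua⟩
    · rintro ⟨he, hB, hab, hua⟩
      exact ⟨⟨he, hB, hab⟩, not_not.2 hua⟩

omit [Fintype E] [Fintype V] [DecidableEq V] hcu hac hbc in
/-- The red connections of `complE e S` are the blue connections of `S`, away from `c`. -/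
theorem conn_complE_iff {S : Config E} {x y : V} (hx : x ≠ c) (hy : y ≠ c) :
    G.Conn (complE e S) x y ↔ G.Conn Sᶜ x y :=
  conn_update_iff_of_ne hleaf hend hx hy true

omit [Fintype E] [Fintype V] [DecidableEq V] hcu hac hbc in
/-- The blue connections of `complE e S` are the red connections of `S`, away from `c`. -/
theorem conn_compl_complE_iff {S : Config E} {x y : V} (hx : x ≠ c) (hy : y ≠ c) :
    G.Conn (complE e S)ᶜ x y ↔ G.Conn S x y := by
  unfold complE
  rw [compl_update_eq, compl_compl]
  exact conn_update_iff_of_ne hleaf hend hx hy false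

omit [Fintype V] [DecidableEq V] in
open Classical in
/-- **`U(D,B) = U(B,D)`**: complementation with `e` re-opened swaps red and blue away from `c`. -/
theorem card_DB_eq_card_BD :
    (univ.filter fun S : Config E => S e = true ∧ ((G.Conn S u a ∧ G.Conn S u b) ∧
        ((G.Conn Sᶜ u a ∧ ¬ G.Conn Sᶜ u b) ∨ (G.Conn Sᶜ u b ∧ ¬ G.Conn Sᶜ u a)))).card =
      (univ.filter fun S : Config E => S e = true ∧
        (((G.Conn S u a ∧ ¬ G.Conn S u b) ∨ (G.Conn S u b ∧ ¬ G.Conn S u a)) ∧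
        (G.Conn Sᶜ a b ∧ G.Conn Sᶜ u a))).card := by
  refine Finset.card_nbij' (complE e) (complE e) ?_ ?_ ?_ ?_
  · intro S hS
    simp only [coe_filter, mem_univ, true_and, Set.mem_setOf_eq] at hS ⊢
    obtain ⟨he, ⟨hua, hub⟩, hB⟩ := hS
    refine ⟨complE_apply_self S, ?_, ?_, ?_⟩
    · rw [conn_complE_iff hleaf hend hcu hac, conn_complE_iff hleaf hend hcu hbc]
      exact hB
    · rw [conn_compl_complE_iff hleaf hend hac hbc]
      exact hua.symm.trans hub
    · rw [conn_compl_complE_iff hleaf hend hcu hac]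
      exact hua
  · intro T hT
    simp only [coe_filter, mem_univ, true_and, Set.mem_setOf_eq] at hT ⊢
    obtain ⟨he, hB, hab, hua⟩ := hT
    refine ⟨complE_apply_self T, ⟨?_, ?_⟩, ?_⟩
    · rw [conn_complE_iff hleaf hend hcu hac]
      exact hua
    · rw [conn_complE_iff hleaf hend hcu hbc]
      exact hua.trans hab
    · rw [conn_compl_complE_iff hleaf hend hcu hac, conn_compl_complE_iff hleaf hend hcu hbc]
      exact hB
  · intro S hS
    simp only [coe_filter, mem_univ, true_and, Set.mem_setOf_eq] at hS
    exact complE_complE hS.1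
  · intro T hT
    simp only [coe_filter, mem_univ, true_and, Set.mem_setOf_eq] at hT
    exact complE_complE hT.1


end Identities

end Count

end Pendant

end MultiGraph

end PercRepro
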